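import Summits.Schanuel.Schanuel.Theorems.ZilberEacGraphLift
import HarnessLib

/-!
# The graph lift `W^f(S)`, II: torus part, base, freeness

Zilber's Exponential-Algebraic Closedness, case ladder (host summit Schanuel, cell `pub-schanuel`,
seat 2, gen 6).  Continuation of `ZilberEacGraphLift`: for `S ⊆ ℂ^d × ℂ^d` and `f ∈ ℂ[x]`, the
torus part of the graph lift `W^f(S) = {s ∈ S, x_last = f(x_s)}` is `{graphPt f s t : s ∈ S ∩ G^d,
t ≠ 0}`; its base is the graph of `f` over the base `π(S ∩ G^d)`, so `addProjDim W^f(S) = addProjDim S`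
(`addProjDim_graphVar`); multiplicative freeness lifts (`isMulFree_graphVar`, the new coordinate
`y_last` is free), and additive freeness lifts as soon as no nonzero integer multiple of `f` is
congruent to an affine `ℤ`-linear form on the base (`isAddFree_graphVar`).

HONEST FRAMING: bookkeeping towards `ECCell (n+1) d → ECCell n d`; `EC(3,2)` OPEN; nothing here
bears on Schanuel's conjecture (EAC ⇏ SC).
-/

noncomputable section

open MvPolynomial
open Literature.NumberTheory.Transcendental Literature.ModelTheory.Zilber

set_option linter.dupNamespace false

namespace Summit.Schanuel.Schanuel.Theorems

variable {d : ℕ} (f : MvPolynomial (Fin d) ℂ) {S : Set (Fin d ⊕ Fin d → ℂ)}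

/-! ## The torus part of the graph lift -/

/-- `graphPt f s t` is a torus point iff `s` is and `t ≠ 0`. [folklore] -/
theorem graphPt_mem_torusLocus_iff (s : Fin d ⊕ Fin d → ℂ) (t : ℂ) :
    graphPt f s t ∈ torusLocus ℂ (d + 1) ↔ s ∈ torusLocus ℂ d ∧ t ≠ 0 := by
  rw [mem_torusLocus_iff, mem_torusLocus_iff, Fin.forall_fin_succ']
  simp only [graphPt_inr_castSucc, graphPt_inr_last]

/-- **The torus part of `W^f(S)`** consists of the `graphPt f s t` with `s ∈ S ∩ G^d`, `t ≠ 0`.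
[folklore] -/
theorem mem_graphVar_inter_torusLocus_iff {w : Fin (d + 1) ⊕ Fin (d + 1) → ℂ} :
    w ∈ graphVar f S ∩ torusLocus ℂ (d + 1) ↔
      ∃ s ∈ S ∩ torusLocus ℂ d, ∃ t : ℂ, t ≠ 0 ∧ w = graphPt f s t := by
  constructor
  · rintro ⟨hw, hT⟩
    obtain ⟨s, hs, t, rfl⟩ := (mem_graphVar_iff f).1 hw
    obtain ⟨hsT, ht⟩ := (graphPt_mem_torusLocus_iff f s t).1 hT
    exact ⟨s, ⟨hs, hsT⟩, t, ht, rfl⟩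
  · rintro ⟨s, ⟨hs, hsT⟩, t, ht, rfl⟩
    exact ⟨(graphPt_mem_graphVar_iff f s t).2 hs, (graphPt_mem_torusLocus_iff f s t).2 ⟨hsT, ht⟩⟩

/-- `graphPt f s t` lies in the torus part for `s ∈ S ∩ G^d`, `t ≠ 0`. [folklore] -/
theorem graphPt_mem_graphVar_inter_torusLocus {s : Fin d ⊕ Fin d → ℂ}
    (hs : s ∈ S ∩ torusLocus ℂ d) {t : ℂ} (ht : t ≠ 0) :
    graphPt f s t ∈ graphVar f S ∩ torusLocus ℂ (d + 1) :=
  (mem_graphVar_inter_torusLocus_iff f).2 ⟨s, hs, t, ht, rfl⟩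

/-- The torus part of the graph lift is nonempty when `S ∩ G^d` is. [folklore] -/
theorem graphVar_inter_torusLocus_nonempty (hne : (S ∩ torusLocus ℂ d).Nonempty) :
    (graphVar f S ∩ torusLocus ℂ (d + 1)).Nonempty := by
  obtain ⟨s, hs⟩ := hne
  exact ⟨_, graphPt_mem_graphVar_inter_torusLocus f hs one_ne_zero⟩

/-- The projection of the torus part is `S ∩ G^d`. [folklore] -/
theorem image_pr_graphVar_inter_torusLocus :
    (fun (w : Fin (d + 1) ⊕ Fin (d + 1) → ℂ) (t : Fin d ⊕ Fin d) =>
        w (Sum.map Fin.castSucc Fin.castSucc t)) '' (graphVar f S ∩ torusLocus ℂ (d + 1)) =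
      S ∩ torusLocus ℂ d := by
  ext s
  constructor
  · rintro ⟨w, hw, rfl⟩
    obtain ⟨s, hs, t, -, rfl⟩ := (mem_graphVar_inter_torusLocus_iff f).1 hw
    beta_reduce
    rwa [pr_graphPt]
  · intro hs
    exact ⟨graphPt f s 1, graphPt_mem_graphVar_inter_torusLocus f hs one_ne_zero, pr_graphPt f s 1⟩

/-! ## The base: the graph of `f` over `π(S ∩ G^d)` -/

/-- Points of the base: `(π s, f(π s))` with `s ∈ S ∩ G^d`. [folklore] -/
theorem mem_projAdd_image_graphVar_iff {v : Fin (d + 1) → ℂ} :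
    v ∈ projAdd '' (graphVar f S ∩ torusLocus ℂ (d + 1)) ↔
      ∃ s ∈ S ∩ torusLocus ℂ d, v = Fin.snoc (projAdd s) (MvPolynomial.eval (projAdd s) f) := by
  constructor
  · rintro ⟨w, hw, rfl⟩
    obtain ⟨s, hs, t, -, rfl⟩ := (mem_graphVar_inter_torusLocus_iff f).1 hw
    exact ⟨s, hs, projAdd_graphPt f s t⟩
  · rintro ⟨s, hs, rfl⟩
    exact ⟨_, graphPt_mem_graphVar_inter_torusLocus f hs one_ne_zero, projAdd_graphPt f s 1⟩

/-- The substitution `ℂ[x, x_last] → ℂ[x]`, `x_last ↦ f`. [folklore] -/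
def graphBaseHom : MvPolynomial (Fin (d + 1)) ℂ →ₐ[ℂ] MvPolynomial (Fin d) ℂ :=
  MvPolynomial.aeval (Fin.snoc X f)

/-- `graphBaseHom` on a small variable. [folklore] -/
@[simp] theorem graphBaseHom_X_castSucc (i : Fin d) :
    graphBaseHom f (X (Fin.castSucc i)) = X i := by
  simp [graphBaseHom]

/-- `graphBaseHom` on `x_last`. [folklore] -/
@[simp] theorem graphBaseHom_X_last : graphBaseHom f (X (Fin.last d)) = f := by
  simp [graphBaseHom]

/-- `graphBaseHom f (rename castSucc c) = c`: the substitution is onto. [folklore] -/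
theorem graphBaseHom_rename (c : MvPolynomial (Fin d) ℂ) :
    graphBaseHom f (rename Fin.castSucc c) = c := by
  rw [graphBaseHom, aeval_rename]
  have : (Fin.snoc X f : Fin (d + 1) → MvPolynomial (Fin d) ℂ) ∘ Fin.castSucc = X := by
    funext i
    exact Fin.snoc_castSucc (α := fun _ => MvPolynomial (Fin d) ℂ) _ _ i
  rw [this, aeval_X_left, AlgHom.coe_id, id_eq]

/-- **Evaluation at a graph point** factors through the substitution:
`p(b, f(b)) = (graphBaseHom f p)(b)`. [folklore] -/
theorem eval_snoc_eval (b : Fin d → ℂ) (p : MvPolynomial (Fin (d + 1)) ℂ) :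
    MvPolynomial.eval (Fin.snoc b (MvPolynomial.eval b f) : Fin (d + 1) → ℂ) p =
      MvPolynomial.eval b (graphBaseHom f p) := by
  induction p using MvPolynomial.induction_on with
  | C a =>
    rw [eval_C]
    change a = MvPolynomial.eval b (graphBaseHom f (algebraMap ℂ _ a))
    rw [AlgHom.commutes, MvPolynomial.algebraMap_eq, eval_C]
  | add p q hp hq => rw [map_add, map_add, map_add, hp, hq]
  | mul_X p j hp =>
    rw [map_mul, map_mul, map_mul, hp, eval_X]
    congr 1
    rcases Fin.eq_castSucc_or_eq_last j with ⟨i, rfl⟩ | rfl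
    · rw [Fin.snoc_castSucc, graphBaseHom_X_castSucc, eval_X]
    · rw [Fin.snoc_last, graphBaseHom_X_last]

/-- **The base of `W^f(S)`**: `I(π(W^f(S) ∩ Gⁿ⁺¹)) = graphBaseHom⁻¹ (I(π(S ∩ Gⁿ)))`. [folklore] -/
theorem vanishingIdeal_projAdd_graphVar :
    vanishingIdeal ℂ (projAdd '' (graphVar f S ∩ torusLocus ℂ (d + 1))) =
      (vanishingIdeal ℂ (projAdd '' (S ∩ torusLocus ℂ d))).comap (graphBaseHom f) := by
  ext p
  rw [Ideal.mem_comap, mem_vanishingIdeal_iff, mem_vanishingIdeal_iff]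
  constructor
  · intro h
    rintro _ ⟨s, hs, rfl⟩
    have := h _ ((mem_projAdd_image_graphVar_iff f).2 ⟨s, hs, rfl⟩)
    change MvPolynomial.eval _ p = 0 at this
    rw [eval_snoc_eval] at this
    exact this
  · intro h v hv
    obtain ⟨s, hs, rfl⟩ := (mem_projAdd_image_graphVar_iff f).1 hv
    change MvPolynomial.eval _ p = 0
    rw [eval_snoc_eval]
    exact h _ ⟨s, hs, rfl⟩

/-- `graphBaseHom f` is onto. [folklore] -/
theorem graphBaseHom_surjective : Function.Surjective (graphBaseHom f) :=
  fun c => ⟨rename Fin.castSucc c, graphBaseHom_rename f c⟩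

/-- **`addProjDim W^f(S) = addProjDim S`**: the base of the lift is the graph of `f` over the base of
`S` (coordinate rings `ℂ[x, x_last]/graphBaseHom⁻¹(I(B)) ≅ ℂ[x]/I(B)`). [folklore] -/
theorem addProjDim_graphVar : addProjDim ℂ (d + 1) (graphVar f S) = addProjDim ℂ d S := by
  unfold addProjDim zariskiDim
  rw [vanishingIdeal_projAdd_graphVar]
  set I := vanishingIdeal ℂ (projAdd '' (S ∩ torusLocus ℂ d)) with hI
  have hker : RingHom.ker ((Ideal.Quotient.mk I).comp (graphBaseHom f).toRingHom) =
      I.comap (graphBaseHom f) := by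
    rw [← RingHom.comap_ker, Ideal.mk_ker]
    rfl
  have hsurj : Function.Surjective ((Ideal.Quotient.mk I).comp (graphBaseHom f).toRingHom) :=
    Ideal.Quotient.mk_surjective.comp (graphBaseHom_surjective f)
  exact ringKrullDim_eq_of_ringEquiv (S := MvPolynomial (Fin d) ℂ ⧸ I)
    ((Ideal.quotEquivOfEq hker.symm).trans (RingHom.quotientKerEquivOfSurjective hsurj))

/-! ## Freeness -/

/-- The `ℤ`-linear form of `m` at `graphPt f s t`. [folklore] -/
theorem sum_graphPt_inl (m : Fin (d + 1) → ℤ) (s : Fin d ⊕ Fin d → ℂ) (t : ℂ) :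
    (∑ j, (m j : ℂ) * graphPt f s t (Sum.inl j)) =
      (∑ i : Fin d, (m (Fin.castSucc i) : ℂ) * s (Sum.inl i)) +
        (m (Fin.last d) : ℂ) * MvPolynomial.eval (projAdd s) f := by
  rw [Fin.sum_univ_castSucc]
  simp only [graphPt_inl_castSucc, graphPt_inl_last]
  rfl

/-- The monomial of `m` at `graphPt f s t`. [folklore] -/
theorem prod_graphPt_inr (m : Fin (d + 1) → ℤ) (s : Fin d ⊕ Fin d → ℂ) (t : ℂ) :
    (∏ j, graphPt f s t (Sum.inr j) ^ m j) =
      (∏ i : Fin d, s (Sum.inr i) ^ m (Fin.castSucc i)) * t ^ m (Fin.last d) := by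
  rw [Fin.prod_univ_castSucc]
  simp only [graphPt_inr_castSucc, graphPt_inr_last]

/-- **Multiplicative freeness lifts** (the new coordinate `y_last` is free). [folklore] -/
theorem isMulFree_graphVar (hne : (S ∩ torusLocus ℂ d).Nonempty)
    (hmul : IsMulFree ℂ d (S ∩ torusLocus ℂ d)) :
    IsMulFree ℂ (d + 1) (graphVar f S ∩ torusLocus ℂ (d + 1)) := by
  intro m hm
  rintro ⟨c, hc⟩
  obtain ⟨s₀, hs₀⟩ := hne
  by_cases hml : m (Fin.last d) = 0
  · have hm' : (fun i : Fin d => m (Fin.castSucc i)) ≠ 0 := fun h => hm (by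
      funext j
      rcases Fin.eq_castSucc_or_eq_last j with ⟨i, rfl⟩ | rfl
      exacts [congrFun h i, hml])
    refine hmul (fun i => m (Fin.castSucc i)) hm' ⟨c, fun z hz => ?_⟩
    have h1 := hc _ (graphPt_mem_graphVar_inter_torusLocus f hz one_ne_zero)
    rwa [prod_graphPt_inr, hml, zpow_zero, mul_one] at h1
  · have h1 := hc _ (graphPt_mem_graphVar_inter_torusLocus f hs₀ one_ne_zero)
    have h2 := hc _ (graphPt_mem_graphVar_inter_torusLocus f hs₀ two_ne_zero)
    rw [prod_graphPt_inr, one_zpow, mul_one] at h1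
    rw [prod_graphPt_inr, h1] at h2
    have hc0 : c ≠ 0 := by
      rw [← h1]
      exact Finset.prod_ne_zero_iff.2 fun i _ => zpow_ne_zero _ (hs₀.2 i)
    have h3 : (2 : ℂ) ^ m (Fin.last d) = 1 := by
      have := h2
      nth_rw 2 [← mul_one c] at this
      exact mul_left_cancel₀ hc0 this
    have h4 : (2 : ℝ) ^ m (Fin.last d) = (2 : ℝ) ^ (0 : ℤ) := by
      have := congrArg (fun z : ℂ => ‖z‖) h3
      simp only [norm_zpow, Complex.norm_ofNat, norm_one] at this
      rw [this, zpow_zero]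
    exact hml (zpow_right_injective₀ (by norm_num) (by norm_num) h4)

/-- **Additive freeness lifts** when `S ∩ G^d` is additively free and no nonzero integer multiple of
`f` is congruent on the base to an affine `ℤ`-linear form. [folklore] -/
theorem isAddFree_graphVar (hadd : IsAddFree ℂ d (S ∩ torusLocus ℂ d))
    (hf : ∀ (m : Fin d → ℤ) (q : ℤ), q ≠ 0 → ∀ c : ℂ, ¬ ∀ z ∈ S ∩ torusLocus ℂ d,
      (∑ i, (m i : ℂ) * z (Sum.inl i)) + (q : ℂ) * MvPolynomial.eval (projAdd z) f = c) :
    IsAddFree ℂ (d + 1) (graphVar f S ∩ torusLocus ℂ (d + 1)) := by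
  intro m hm
  rintro ⟨c, hc⟩
  by_cases hml : m (Fin.last d) = 0
  · have hm' : (fun i : Fin d => m (Fin.castSucc i)) ≠ 0 := fun h => hm (by
      funext j
      rcases Fin.eq_castSucc_or_eq_last j with ⟨i, rfl⟩ | rfl
      exacts [congrFun h i, hml])
    refine hadd (fun i => m (Fin.castSucc i)) hm' ⟨c, fun z hz => ?_⟩
    have h1 := hc _ (graphPt_mem_graphVar_inter_torusLocus f hz one_ne_zero)
    rwa [sum_graphPt_inl, hml, Int.cast_zero, zero_mul, add_zero] at h1
  · refine hf (fun i => m (Fin.castSucc i)) (m (Fin.last d)) hml c fun z hz => ?_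
    have h1 := hc _ (graphPt_mem_graphVar_inter_torusLocus f hz one_ne_zero)
    rwa [sum_graphPt_inl] at h1

end Summit.Schanuel.Schanuel.Theorems
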